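import Summits.KontsevichZagierPeriods.KontsevichZagierPeriods.Theses.HurwitzMicroSectors
import Summits.KontsevichZagierPeriods.KontsevichZagierPeriods.Theorems.HurwitzMicroSectorsNormalFormPrinciplePiBoxTransfer
import Summits.KontsevichZagierPeriods.KontsevichZagierPeriods.Theorems.HurwitzMicroSectorsNormalFormPrincipleVariants2200

/-! TTRL-lite variant V2251 of stmt-KontsevichZagierPeriods-3869

Variant V2251 = `stub_boxRigidity` (the leaf `BoxRigidity` of `NormalFormPrinciple`: two box-rational
representations with equal values are KZ-equivalent) under the extra hypothesis `m' ≤ 5` (move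
`bound_nat:m'≤5`, the left dimension `m` free). Verdict of the attempt seat: **open, and provably as hard
as the parent** — this file is the certificate, not a proof of the variant. A ONE-sided dimension bound
never weakens the leaf: the bounded side still contains the `0`-dimensional box, whose zero
representation is box-rational of value `0`, so the bounded statement already yields BoxVanishing in
every dimension (`boxVanishing_of_boxRigidityRight 0`, `boxVanishing_of_boxRigidityLeft 0`, tree) and
BoxVanishing is BoxRigidity (`boxRigidity_of_boxVanishing`, tree) — packaged as `boxRigidityRight_iff 0`
(tree, `…Variants2200.lean`); the general bounds `boxRigidityRightLe_iff k` / `boxRigidityLeftLe_iff k`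
are in `…Variants2256.lean` (sibling variant `m' ≤ 6`); here `k = 5`. Hence `KontsevichZagierPeriods → V2251 → KZ.PiLocalKernel`
and `KontsevichZagierPeriods ↔ V2251 ∧ KZ.PiCancellation`: the variant sits between the Summit and
Ayoub's localised kernel conjecture (`@[conjecture]`, open), so it is neither provable nor refutable from
the tree, and the programmatic moves `bound_nat:m'≤k` / `bound_nat:m≤k` of this stub never produce an
easier statement (only the TWO-sided bounds `m, m' ≤ k` do; `k ≤ 1` is `boxRigidity_of_le_one`, Baker).
Source: M. Kontsevich, D. Zagier, *Periods* (2001), §1.2 Conjecture 1; J. Ayoub, EMS Newsl. 91 (2014),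
Conj. 7. Pure proof file, no definitions. -/

-- `Summit.<Summit>.<Problem>` is the tree's mandated summit-side namespace (CONVENTIONS §2); for this
-- single-conjunct summit the two coincide, so the duplicate is deliberate.
set_option linter.dupNamespace false

noncomputable section

namespace Summit.KontsevichZagierPeriods.KontsevichZagierPeriods.Theorems

open MeasureTheory Set
open Literature.NumberTheory.Transcendental Literature.NumberTheory.Transcendental.KZ
open Summit.KontsevichZagierPeriods.KontsevichZagierPeriods.Theses.HurwitzMicroSectors
open Summit.KontsevichZagierPeriods.HurwitzMicroSectors.NormalFormPrinciple.PiBox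

/-! ## The variant V2251 itself: between the Summit and `KZ.PiLocalKernel` -/

/-- **V2251 ⟺ the parent leaf `BoxRigidity`** : specialise the bounded side to
`m' = 0` and apply `boxRigidityRight_iff 0` (tree); equals `boxRigidityRightLe_iff 5` of `…Variants2256.lean`.
[cite: KontsevichZagier2001, §1.2 Conjecture 1] -/
theorem stub_boxRigidity_var2251_iff_parent :
    (∀ (m m' : ℕ) (N : IntegralRep m) (N' : IntegralRep m'), m' ≤ 5 → N.domain = {x | ∀ i, x i ∈ Set.Ioo (0:ℝ) 1} → N.IsRational → N'.domain = {x | ∀ i, x i ∈ Set.Ioo (0:ℝ) 1} → N'.IsRational → N.value = N'.value → Equivalent N N') ↔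
    (∀ (m m' : ℕ) (N : IntegralRep m) (N' : IntegralRep m'), N.domain = {x | ∀ i, x i ∈ Set.Ioo (0:ℝ) 1} → N.IsRational → N'.domain = {x | ∀ i, x i ∈ Set.Ioo (0:ℝ) 1} → N'.IsRational → N.value = N'.value → Equivalent N N') :=
  ⟨fun h => (boxRigidityRight_iff 0).1 fun m N N' => h m 0 N N' (Nat.zero_le 5),
    fun h m m' N N' _ => h m m' N N'⟩

/-- **V2251 ⇒ `KZ.PiLocalKernel`** (Ayoub's localised kernel conjecture for this calculus — open): a
proof of the variant would settle an open conjecture of the tree. [cite: Ayoub2014, Def. 6 and Conj. 7] -/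
theorem piLocalKernel_of_stub_boxRigidity_var2251
    (h : ∀ (m m' : ℕ) (N : IntegralRep m) (N' : IntegralRep m'), m' ≤ 5 → N.domain = {x | ∀ i, x i ∈ Set.Ioo (0:ℝ) 1} → N.IsRational → N'.domain = {x | ∀ i, x i ∈ Set.Ioo (0:ℝ) 1} → N'.IsRational → N.value = N'.value → Equivalent N N') :
    PiLocalKernel :=
  piLocalKernel_of_boxRigidity (stub_boxRigidity_var2251_iff_parent.1 h)

/-- **`KontsevichZagierPeriods ⇒ V2251`**: the variant is a special case of Conjecture 1 for the
tree's calculus — a refutation of the variant would refute the Summit. [cite: KontsevichZagier2001, §1.2 Conjecture 1] -/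
theorem stub_boxRigidity_var2251_of_statement (h : _root_.KontsevichZagierPeriods) :
    ∀ (m m' : ℕ) (N : IntegralRep m) (N' : IntegralRep m'), m' ≤ 5 → N.domain = {x | ∀ i, x i ∈ Set.Ioo (0:ℝ) 1} → N.IsRational → N'.domain = {x | ∀ i, x i ∈ Set.Ioo (0:ℝ) 1} → N'.IsRational → N.value = N'.value → Equivalent N N' :=
  fun m m' N N' _ => (leaves_of_statement h).1 m m' N N'

/-- **Summit ⟺ V2251 ∧ PiCancellation** (from `statement_iff_leaves`): with `π`-cancellation the variant
is exactly what the Summit needs, no more and no less. [cite: KontsevichZagier2001, §1.2 Conjecture 1] -/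
theorem statement_iff_stub_boxRigidity_var2251_and_piCancellation :
    _root_.KontsevichZagierPeriods ↔
    ((∀ (m m' : ℕ) (N : IntegralRep m) (N' : IntegralRep m'), m' ≤ 5 → N.domain = {x | ∀ i, x i ∈ Set.Ioo (0:ℝ) 1} → N.IsRational → N'.domain = {x | ∀ i, x i ∈ Set.Ioo (0:ℝ) 1} → N'.IsRational → N.value = N'.value → Equivalent N N') ∧
      PiCancellation) := by
  rw [statement_iff_leaves, stub_boxRigidity_var2251_iff_parent]

end Summit.KontsevichZagierPeriods.KontsevichZagierPeriods.Theorems
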